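import Mathlib.RepresentationTheory.Basic
import Mathlib.LinearAlgebra.Dimension.Finrank
import Mathlib.Analysis.Complex.Basic
import HarnessLib

/-!
# Product mixing in quasirandom groups (Gowers 2008, Theorem 3.3) — typed literature

Topic `Literature/GroupTheory/QuasirandomGroups`.  ONE named fact `Gowers2008_thm_3_3`, the general
form of which `alternatingProductMixing` (`AlternatingProductMixing.lean`, the consumer statement of
the `ValiantsHypothesis` line «mixing-scale» on stmt-18293) is the special case `G = 𝔄_n`,
`k = n − 1`.  PROVED in the companion `ProductMixingProofs.lean` (`Gowers2008_thm_3_3_holds`).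
No instance, no notation.

## Source (materialised pages) and statement

W. T. Gowers, *Quasirandom groups*, Combin. Probab. Comput. **17** (2008) 363–387 [Gowers2008];
held text `paper:arxiv-0710.3877`, p0005.txt L100–108, verbatim: "**Theorem 3.3.** Let `Γ` be a
finite group with no non-trivial representation of dimension less than `k`, let `n = |Γ|` and let
`A`, `B` and `C` be three subsets of `Γ` such that `|A||B||C| > n³/k`.  Then there exist `a ∈ A`,
`b ∈ B` and `c ∈ C` with `ab = c`.  In particular, this is true if all of `A`, `B` and `C` have
size greater than `n/k^{1/3}`.  Furthermore, if `η > 0` and `|A||B||C| ≥ n³/η²k`, then the number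
of triples `(a,b,c) ∈ A × B × C` such that `ab = c` is at least `(1 − η)|A||B||C|/n`."

Rendering: "representation" = Mathlib's `Representation ℂ Γ V` on a finite-dimensional `V : Type`
(the tree's convention, `Literature.RepresentationTheory.FiniteGroups.charDegrees`), "non-trivial"
= some element does not act as the identity, so the hypothesis reads "every representation of
dimension `< k` is trivial"; `k ≥ 1` (the printed `n³/k`); triples `(a,b,c)` with `ab = c` are
counted as pairs `(a,b) ∈ A × B` with `ab ∈ C`; the "In particular" sentence is not typed
separately.  Honest framing: typed literature; `VP ≠ VNP` is NOT proved and nothing here is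
progress on it.
-/

namespace Literature.GroupTheory.QuasirandomGroups

/-- **Gowers 2008, Theorem 3.3 (product mixing in quasirandom groups).**  "Let `Γ` be a finite
group with no non-trivial representation of dimension less than `k`, let `n = |Γ|` and let `A`,
`B` and `C` be three subsets of `Γ` such that `|A||B||C| > n³/k`.  Then there exist `a ∈ A`,
`b ∈ B` and `c ∈ C` with `ab = c`. […] Furthermore, if `η > 0` and `|A||B||C| ≥ n³/η²k`, then the
number of triples `(a,b,c) ∈ A × B × C` such that `ab = c` is at least `(1 − η)|A||B||C|/n`."
Representations are Mathlib's `Representation ℂ Γ V` on finite-dimensional `V`; "non-trivial" =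
some element does not act as the identity; `k ≥ 1`; triples counted as pairs `(a,b) ∈ A × B` with
`ab ∈ C`.  Proved in `ProductMixingProofs.lean` (`Gowers2008_thm_3_3_holds`); statement only here. [cite: Gowers2008, Thm. 3.3] -/
def Gowers2008_thm_3_3 : Prop :=
  ∀ (Γ : Type) [Group Γ] [Fintype Γ] [DecidableEq Γ] (k : ℕ), 1 ≤ k →
    (∀ (V : Type) [AddCommGroup V] [Module ℂ V] [FiniteDimensional ℂ V]
        (ρ : Representation ℂ Γ V), Module.finrank ℂ V < k → ∀ g : Γ, ρ g = LinearMap.id) →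
    ∀ (A B C : Finset Γ),
      ((Fintype.card Γ : ℝ) ^ 3 / k < (A.card : ℝ) * B.card * C.card →
        ∃ a ∈ A, ∃ b ∈ B, ∃ c ∈ C, a * b = c) ∧
      ∀ η : ℝ, 0 < η →
        (Fintype.card Γ : ℝ) ^ 3 / (η ^ 2 * k) ≤ (A.card : ℝ) * B.card * C.card →
        (1 - η) * ((A.card : ℝ) * B.card * C.card) / Fintype.card Γ ≤
          (((A ×ˢ B).filter fun p => p.1 * p.2 ∈ C).card : ℝ)

end Literature.GroupTheory.QuasirandomGroups
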